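import Summits.SmoothPoincare4.SmoothPoincare4.Theses.EntropyRung
import Summits.SmoothPoincare4.SmoothPoincare4.Theorems.EntropyRungCompactShrinkerGapEinsteinEndgame
import HarnessLib

/-!
# Route EntropyRung — the Einstein door of crux `CompactShrinkerGap`, as an importable reduction

Crux stmt-SmoothPoincare4-10870 (`EntropyRung.CompactShrinkerGap`): a closed `M ≃ₕ S⁴` carrying a
normalised gradient shrinker `Ric + Hess f = g/2`, `R + |∇f|² = f` of Gaussian mass
`∫ e^{-f} dV > 32π²√π e^{-3/2}` (density above `Θ(S³×ℝ)`) is diffeomorphic to `S⁴`.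

The picked line `Cruxes/CompactShrinkerGap/Lines/cgy_variance_pivot.lean` (v14) types the crux's one
research-open content in six registered strengths behind THREE doors: (A) the Weyl / variance budget,
closing through Chang–Gursky–Yang (importable reduction: `compactGapOfChangGurskyYang_of_weylBudget`,
`EntropyRungCompactGapOfChangGurskyYangReduction.lean`); (E) the EINSTEIN door — the dense shrinker is
Einstein, `Hess f ≡ 0` (registered STUB 26 `stub_denseShrinkerIsEinstein`; the compact half of the
Cao–Hamilton–Ilmanen gap question, CHI 2004 §1/§4) — closing through Gursky's Einstein gap on homotopy
4-spheres and Hamilton's PIC sphere theorem via the LANDED endgame `Theorems.stub_einsteinEndgame`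
(p121858); (C) the ν-summit line. Door E's composition so far lived only in the non-importable
skeleton; this file puts it in the `Theorems` tree:

* `helper_einsteinDoorReduction` (registered helper of stmt-10870): the two named facts
  `gursky_einstein_homotopySphere_four`, `hamilton_pic_sphere_four` (threaded as hypotheses, exactly
  as in `stub_einsteinEndgame`) and the text of STUB 26 (byte-for-byte its registered signature) imply
  the route decl `CompactShrinkerGap` BY NAME. Proof: unfold, feed STUB 26's conclusion `Hess f = 0`
  to the endgame.

So the crux closes by `helper_einsteinDoorReduction hG hPIC Theorems.stub_denseShrinkerIsEinstein`
the moment STUB 26 lands (conditionally on the two facts until their `_holds` exist), with no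
Chang–Gursky–Yang and no Chern–Gauss–Bonnet. Nothing here is a claim that STUB 26 is provable: it is
research-open (Cao–Zhu 2024, Math. Ann. 390, §3, Conj. 1–2; no printed theorem bounds `∫|W|²`, `sup R`,
`Vol` or `osc f` of a compact 4-d shrinker by its density, and none proves dense ⇒ Einstein).

References: M. J. Gursky, Math. Ann. 318 (2000), Thm. 1 [Gursky2000]; R. S. Hamilton, Comm. Anal.
Geom. 5 (1997), Cor. 1.2(a) [Hamilton1997]; H.-D. Cao, R. S. Hamilton, T. Ilmanen, arXiv:math/0404165,
§4 [CaoHamiltonIlmanen2004]; H.-D. Cao, M. Zhu, Math. Ann. 390 (2024), §3 [CaoZhu2023].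
-/

-- the registered namespace `Summit.SmoothPoincare4.SmoothPoincare4.Theorems` repeats a component
set_option linter.dupNamespace false

noncomputable section

open scoped Manifold ContDiff ENNReal ContinuousMap

namespace Summit.SmoothPoincare4.SmoothPoincare4.Theorems

open Summit.SmoothPoincare4.SmoothPoincare4.Theses.EntropyRung

/-- **The Einstein door of `CompactShrinkerGap` (registered helper `helper_einsteinDoorReduction`).**
Under Gursky's Einstein gap on homotopy 4-spheres (`hG`) and Hamilton's PIC sphere theorem (`hPIC`),
both threaded as named-fact hypotheses: IF every dense normalised gradient shrinker on a closed
homotopy 4-sphere — `Ric + Hess f = g/2`, `R + |∇f|² = f`, `∫ e^{-f} dV > 32π²√π e^{-3/2}` — has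
`Hess f ≡ 0` (hypothesis `hE`, verbatim the registered STUB 26 `stub_denseShrinkerIsEinstein` of line
`cgy-variance-pivot`), THEN the route decl `EntropyRung.CompactShrinkerGap` holds: unfold it and apply
the landed Einstein endgame `stub_einsteinEndgame` (p121858: `Hess f = 0` ⇒ `Ric = g/2` ⇒ by Gursky
`M ≃ₘ S⁴` or `Vol ≤ 32π²`, the latter excluded by the Jensen volume floor `Vol > 32π²√π e^{1/2}`).
[cite: Gursky2000, Theorem 1] [cite: Hamilton1997, Cor. 1.2(a)] [cite: CaoHamiltonIlmanen2004, §4] -/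
theorem helper_einsteinDoorReduction :
    Literature.Geometry.Riemannian.gursky_einstein_homotopySphere_four →
    Literature.Geometry.Riemannian.hamilton_pic_sphere_four →
    (∀ (M : Type) [TopologicalSpace M] [T2Space M] [SecondCountableTopology M]
      [ChartedSpace (EuclideanSpace ℝ (Fin 4)) M] [IsManifold (𝓡 4) ∞ M] [CompactSpace M]
      [T3Space M] [MeasurableSpace M] [BorelSpace M],
      M ≃ₕ Metric.sphere (0 : EuclideanSpace ℝ (Fin 5)) 1 →
    ∀ (g : Literature.Geometry.Lorentzian.PseudoRiemannianMetric (𝓡 4) ∞ (EuclideanSpace ℝ (Fin 4))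
        (TangentSpace (𝓡 4) : M → Type _)) [g.HasLeviCivita] (f : M → ℝ) (hg : g.IsRiemannian),
      ContMDiff (𝓡 4) 𝓘(ℝ, ℝ) ∞ f →
      (∀ (x : M) (X Y : TangentSpace (𝓡 4) x),
        g.ricci x X Y + g.hessian f x X Y = (1 / 2 : ℝ) * g.val x X Y) →
      (∀ x : M, g.scalarCurvature x + g.gradSq f x = f x) →
      ENNReal.ofReal (32 * Real.pi ^ 2 * Real.sqrt Real.pi * Real.exp (-(3 : ℝ) / 2)) <
        ∫⁻ x, ENNReal.ofReal (Real.exp (-f x))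
          ∂(Literature.Geometry.Lorentzian.riemannianMeasure (g.toContMDiffRiemannianMetric hg)) →
      ∀ (x : M) (X Y : TangentSpace (𝓡 4) x), g.hessian f x X Y = 0) →
    Summit.SmoothPoincare4.SmoothPoincare4.Theses.EntropyRung.CompactShrinkerGap := by
  intro hG hPIC hE
  unfold CompactShrinkerGap
  intro M _ _ _ _ _ _ _ _ _ e g _ f hg hf hsol hnorm hdens
  exact stub_einsteinEndgame hG hPIC M e g f hg hf hsol hnorm hdens
    (hE M e g f hg hf hsol hnorm hdens)

end Summit.SmoothPoincare4.SmoothPoincare4.Theorems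

end
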